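import Literature.Computability.QuantumComplexity.GaussianRank

/-!
# Negative lemmas for the crux `SpinorFlattening.GaussRankTwoCopies` (stmt-QuantumAdvantage-1248), II:
# annihilators of `|M⟩^{⊗2}` — bit-flip action of the Majoranas, the trivial-annihilator fact, and the sharp
# annihilator-count threshold of the dictionary

Standing adversary (cdisprove gen 2); supporting lemmas only (`--supports`), theorems only, nothing asserts the
route decl. (1) `majorana_mulVec_basisState`: `c_{k,b}|x⟩ = ε|x ⊕ e_k⟩`, `ε ∈ {±1, ±i}` (general `n`), with the
neighbour-amplitude lemmas `row_mulVec_basisState_flip` / `_of_ne` and the annihilation rows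
`annRow_mulVec_basisState`. (2) `magicMPow_two_annihilator_eq_zero`: **`|M⟩^{⊗2}` has trivial annihilator** (input
(T1) of every paper proof filed on the item), hence `magicMPow_two_not_isGaussian`. (3) SHARP LOAD-BEARING
THRESHOLD: with only FOUR independent annihilating rows per term the bound fails with two terms
(`gaussRankTwoCopies_false_with_four_annihilators`: `M⊗M = ½|0⁴⟩⊗(|0⁴⟩+|1⁴⟩) + ½|1⁴⟩⊗(|0⁴⟩+|1⁴⟩)`), one term
never suffices (`gaussRankTwoCopies_oneTerm_free`); `5–7` rows give statements implied by the crux (all even/odd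
spinors of `≤ 3` modes are pure) — so a proof must use at least five of the eight rows of each term.
-/

noncomputable section

set_option linter.dupNamespace false

namespace Summit.QuantumAdvantage.QuantumAdvantage.Theorems.GaussRankTwoCopies.Negative

open Literature.Computability.Cryptography Literature.Computability.QuantumComplexity Matrix

/-- Flipping different wires of one string gives different strings. [folklore] -/
theorem update_not_eq_update_not_iff {n : ℕ} (x : QReg n) {j k : Fin n} :
    Function.update x j (!(x j)) = Function.update x k (!(x k)) ↔ j = k := by
  refine ⟨fun h => ?_, fun h => by rw [h]⟩
  by_contra hjk
  have h1 := congrFun h j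
  rw [Function.update_self, Function.update_of_ne hjk] at h1
  exact (Bool.eq_not_self (x j)).mp h1.symm

/-- The Jordan–Wigner sign `∏_{i<k} Z_{x_i x_i} = ±1` (the literal product of the diagonal `Z`/`I` entries
of the Majorana word off the wire `k`) is nonzero: it squares to one. [folklore] -/
theorem jwSign_ne_zero {n : ℕ} (x : QReg n) (k : Fin n) :
    (∏ i ∈ Finset.univ.erase k, (if i < k then Pauli.Z else Pauli.I).mat (x i) (x i)) ≠ 0 := fun h => by
  have h1 : (∏ i ∈ Finset.univ.erase k, (if i < k then Pauli.Z else Pauli.I).mat (x i) (x i)) *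
      (∏ i ∈ Finset.univ.erase k, (if i < k then Pauli.Z else Pauli.I).mat (x i) (x i)) = 1 := by
    rw [← Finset.prod_mul_distrib]
    exact Finset.prod_eq_one fun i _ => by split_ifs <;> cases x i <;> simp
  rw [h, mul_zero] at h1
  exact zero_ne_one h1

/-- **Majoranas flip one bit of a basis state**: `c_{k,b} |x⟩ = ε · |x ⊕ e_k⟩` with
`ε = (X/Y)_{¬x_k, x_k} · ∏_{i<k} Z_{x_i x_i} ∈ {±1, ±i}`. [folklore] -/
theorem majorana_mulVec_basisState {n : ℕ} (k : Fin n) (b : Bool) (x : QReg n) :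
    majorana n k b *ᵥ basisState x =
      ((if b then Pauli.Y else Pauli.X).mat (!(x k)) (x k) *
        ∏ i ∈ Finset.univ.erase k, (if i < k then Pauli.Z else Pauli.I).mat (x i) (x i)) •
      basisState (Function.update x k (!(x k))) := by
  funext y
  simp only [basisState, Matrix.mulVec_single_one, Matrix.col_apply, majorana_apply, Pi.smul_apply,
    smul_eq_mul]
  by_cases hy : y = Function.update x k (!(x k))
  · rw [hy, Pi.single_eq_same, mul_one, Function.update_self]
    congr 1
    exact Finset.prod_congr rfl fun i hi => by rw [Function.update_of_ne (Finset.ne_of_mem_erase hi)]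
  · rw [Pi.single_eq_of_ne hy, mul_zero]
    by_cases hk : y k = x k
    · have h0 : (if b then Pauli.Y else Pauli.X).mat (y k) (x k) = 0 := by
        rw [hk]; cases b <;> simp
      rw [h0, zero_mul]
    · obtain ⟨i, hik, hi⟩ : ∃ i, i ≠ k ∧ y i ≠ x i := by
        by_contra hcon
        push Not at hcon
        apply hy
        funext i
        by_cases hik : i = k
        · rw [hik, Function.update_self]
          exact Bool.eq_not_of_ne hk
        · rw [Function.update_of_ne hik]
          exact hcon i hik
      have h0 : (if i < k then Pauli.Z else Pauli.I).mat (y i) (x i) = 0 := by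
        split_ifs <;> simp [hi]
      rw [Finset.prod_eq_zero (Finset.mem_erase.mpr ⟨hik, Finset.mem_univ i⟩) h0, mul_zero]

/-- `c(A)|x⟩ = Σ_p A_p c_p |x⟩` expanded over the neighbours of `x`. [folklore] -/
theorem row_mulVec_basisState {n : ℕ} (A : Fin n × Bool → ℂ) (x : QReg n) :
    (∑ p : Fin n × Bool, A p • majorana n p.1 p.2) *ᵥ basisState x =
      ∑ p : Fin n × Bool, (A p * ((if p.2 then Pauli.Y else Pauli.X).mat (!(x p.1)) (x p.1) *
        ∏ i ∈ Finset.univ.erase p.1, (if i < p.1 then Pauli.Z else Pauli.I).mat (x i) (x i))) •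
          basisState (Function.update x p.1 (!(x p.1))) := by
  rw [Matrix.sum_mulVec]
  refine Finset.sum_congr rfl fun p _ => ?_
  rw [Matrix.smul_mulVec, majorana_mulVec_basisState, smul_smul]

/-- **Neighbour amplitude.** On `x ⊕ e_k` only the two Majoranas of wire `k` contribute to `c(A)|x⟩`:
the amplitude is `(JW sign) · (A_{k,X} X_{¬x_k,x_k} + A_{k,Y} Y_{¬x_k,x_k})`. [folklore] -/
theorem row_mulVec_basisState_flip {n : ℕ} (A : Fin n × Bool → ℂ) (x : QReg n) (k : Fin n) :
    ((∑ p : Fin n × Bool, A p • majorana n p.1 p.2) *ᵥ basisState x) (Function.update x k (!(x k))) =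
      (∏ i ∈ Finset.univ.erase k, (if i < k then Pauli.Z else Pauli.I).mat (x i) (x i)) *
        (A (k, false) * Pauli.X.mat (!(x k)) (x k) + A (k, true) * Pauli.Y.mat (!(x k)) (x k)) := by
  rw [row_mulVec_basisState, Finset.sum_apply]
  simp only [Pi.smul_apply, basisState_apply, smul_eq_mul, mul_ite, mul_one, mul_zero]
  simp_rw [update_not_eq_update_not_iff x]
  rw [Fintype.sum_prod_type, Finset.sum_eq_single k]
  · rw [Fintype.sum_bool, if_pos rfl, if_pos rfl]
    simp only [Bool.false_eq_true, ↓reduceIte]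
    ring
  · intro a _ hak
    simp [Ne.symm hak]
  · simp

/-- `c(A)|x⟩` vanishes off the Hamming-1 neighbours of `x`. [folklore] -/
theorem row_mulVec_basisState_of_ne {n : ℕ} (A : Fin n × Bool → ℂ) (x y : QReg n)
    (h : ∀ j, y ≠ Function.update x j (!(x j))) :
    ((∑ p : Fin n × Bool, A p • majorana n p.1 p.2) *ᵥ basisState x) y = 0 := by
  rw [row_mulVec_basisState, Finset.sum_apply]
  exact Finset.sum_eq_zero fun p _ => by simp [h p.1]

/-- From the two neighbour amplitudes at an all-`0` and an all-`1` reading of the same wire: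
`u + i v = 0 = u - i v ⇒ u = v = 0`. [folklore] -/
theorem coeffs_eq_zero_of_pm {u v : ℂ}
    (h0 : u * Pauli.X.mat (!false) false + v * Pauli.Y.mat (!false) false = 0)
    (h1 : u * Pauli.X.mat (!true) true + v * Pauli.Y.mat (!true) true = 0) : u = 0 ∧ v = 0 := by
  have h0' : u + v * Complex.I = 0 := by simpa using h0
  have h1' : u - v * Complex.I = 0 := by simpa [sub_eq_add_neg] using h1
  have hv : v * (2 * Complex.I) = 0 := by linear_combination h0' - h1'
  have hv' : v = 0 := by simpa [Complex.I_ne_zero] using hv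
  exact ⟨by linear_combination (h0' + h1') / 2, hv'⟩

/-- The annihilation row of wire `k` reading bit `c`, `c_{k,X} + (-1)^c i c_{k,Y}`, as a coefficient
row summed against the Majoranas. [cite: DiasKoenig2024, §2.1 eq. (11)] -/
theorem annRow_eq {n : ℕ} (k : Fin n) (c : Bool) :
    (∑ p : Fin n × Bool, (fun p : Fin n × Bool => if p.1 = k then
        (if p.2 then (if c then -Complex.I else Complex.I) else (1 : ℂ)) else 0) p • majorana n p.1 p.2) =
      majorana n k false + (if c then -Complex.I else Complex.I) • majorana n k true := by
  rw [Fintype.sum_prod_type, Finset.sum_eq_single k]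
  · simp [add_comm]
  · intro j _ hj
    simp [hj]
  · simp

/-- **The row of wire `k` reading `x_k` annihilates `|x⟩`** (`2a_k|x⟩ = 0` if `x_k = 0`,
`2a_k†|x⟩ = 0` if `x_k = 1`). [cite: DiasKoenig2024, §2.1 eq. (11)] -/
theorem annRow_mulVec_basisState {n : ℕ} (k : Fin n) (x : QReg n) {c : Bool} (h : x k = c) :
    (∑ p : Fin n × Bool, (fun p : Fin n × Bool => if p.1 = k then
        (if p.2 then (if c then -Complex.I else Complex.I) else (1 : ℂ)) else 0) p • majorana n p.1 p.2) *ᵥ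
      basisState x = 0 := by
  subst h
  rw [annRow_eq, Matrix.add_mulVec, Matrix.smul_mulVec, majorana_mulVec_basisState,
    majorana_mulVec_basisState, smul_smul, ← add_smul]
  have h0 : Pauli.X.mat (!(x k)) (x k) + (if x k then -Complex.I else Complex.I) * Pauli.Y.mat (!(x k)) (x k)
      = 0 := by
    cases x k <;> simp
  have : (if false then Pauli.Y else Pauli.X).mat (!x k) (x k) *
        (∏ i ∈ Finset.univ.erase k, (if i < k then Pauli.Z else Pauli.I).mat (x i) (x i)) +
      (if x k then -Complex.I else Complex.I) *
        ((if true then Pauli.Y else Pauli.X).mat (!x k) (x k) *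
          ∏ i ∈ Finset.univ.erase k, (if i < k then Pauli.Z else Pauli.I).mat (x i) (x i)) =
      (Pauli.X.mat (!(x k)) (x k) + (if x k then -Complex.I else Complex.I) * Pauli.Y.mat (!(x k)) (x k)) *
        ∏ i ∈ Finset.univ.erase k, (if i < k then Pauli.Z else Pauli.I).mat (x i) (x i) := by
    simp only [Bool.false_eq_true, ↓reduceIte]
    ring
  rw [this, h0, zero_mul, zero_smul]

/-! ### `|M⟩^{⊗2}` as a sum of four basis states -/

/-- The block-constancy test singles out exactly the four strings `0⁸`, `1⁴0⁴`, `0⁴1⁴`, `1⁸`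
(vector-of-bits form, decided by the kernel). [folklore] -/
theorem blockConst_vec_cases (b₀ b₁ b₂ b₃ b₄ b₅ b₆ b₇ : Bool)
    (h : ∀ k : Fin 2, ∀ i : Fin 4, (fun w : Fin (2 * 4) => ![b₀, b₁, b₂, b₃, b₄, b₅, b₆, b₇] w)
        (finProdFinEquiv (k, i)) =
      (fun w : Fin (2 * 4) => ![b₀, b₁, b₂, b₃, b₄, b₅, b₆, b₇] w) (finProdFinEquiv (k, (0 : Fin 4)))) :
    (fun w : Fin (2 * 4) => ![b₀, b₁, b₂, b₃, b₄, b₅, b₆, b₇] w) = (fun _ => false) ∨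
    (fun w : Fin (2 * 4) => ![b₀, b₁, b₂, b₃, b₄, b₅, b₆, b₇] w) = (fun w => decide (w.val < 4)) ∨
    (fun w : Fin (2 * 4) => ![b₀, b₁, b₂, b₃, b₄, b₅, b₆, b₇] w) = (fun w => decide (4 ≤ w.val)) ∨
    (fun w : Fin (2 * 4) => ![b₀, b₁, b₂, b₃, b₄, b₅, b₆, b₇] w) = (fun _ => true) := by
  revert b₀ b₁ b₂ b₃ b₄ b₅ b₆ b₇ h
  decide

/-- A block-constant string on `2 * 4` wires is one of `0⁸`, `1⁴0⁴`, `0⁴1⁴`, `1⁸`. [folklore] -/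
theorem blockConst_cases (x : QReg (2 * 4))
    (h : ∀ k : Fin 2, ∀ i : Fin 4, x (finProdFinEquiv (k, i)) = x (finProdFinEquiv (k, (0 : Fin 4)))) :
    x = (fun _ => false) ∨ x = (fun w => decide (w.val < 4)) ∨ x = (fun w => decide (4 ≤ w.val)) ∨
      x = (fun _ => true) := by
  have hx : x = fun w : Fin (2 * 4) => ![x 0, x 1, x 2, x 3, x 4, x 5, x 6, x 7] w := by
    funext w
    fin_cases w <;> rfl
  rw [hx] at h ⊢
  exact blockConst_vec_cases _ _ _ _ _ _ _ _ h

/-- **`|M⟩^{⊗2}` in the computational basis**: `½ (|0⁸⟩ + |1⁴0⁴⟩ + |0⁴1⁴⟩ + |1⁸⟩)` (block `A` =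
wires `0–3`, block `B` = wires `4–7`). [cite: CudbyStrelchuk2023, §6 Def. 7] -/
theorem magicMPow_two_eq_sum :
    magicMPow 2 = (((Real.sqrt 2 : ℂ)⁻¹) ^ 2) • (basisState (fun _ : Fin (2 * 4) => false) +
      basisState (fun w : Fin (2 * 4) => decide (w.val < 4)) +
      basisState (fun w : Fin (2 * 4) => decide (4 ≤ w.val)) + basisState (fun _ : Fin (2 * 4) => true)) := by
  funext x
  simp only [Pi.smul_apply, Pi.add_apply, basisState_apply, smul_eq_mul]
  rw [magicMPow]
  by_cases h0 : x = fun _ => false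
  · subst h0
    rw [if_pos (by decide), if_pos rfl, if_neg (by decide), if_neg (by decide), if_neg (by decide)]; ring
  by_cases h1 : x = fun w => decide (w.val < 4)
  · subst h1
    rw [if_pos (by decide), if_neg (by decide), if_pos rfl, if_neg (by decide), if_neg (by decide)]; ring
  by_cases h2 : x = fun w => decide (4 ≤ w.val)
  · subst h2
    rw [if_pos (by decide), if_neg (by decide), if_neg (by decide), if_pos rfl, if_neg (by decide)]; ring
  by_cases h3 : x = fun _ => true
  · subst h3
    rw [if_pos (by decide), if_neg (by decide), if_neg (by decide), if_neg (by decide), if_pos rfl]; ring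
  have hbc : ¬ ∀ k : Fin 2, ∀ i : Fin 4, x (finProdFinEquiv (k, i)) = x (finProdFinEquiv (k, (0 : Fin 4))) :=
    fun h => by rcases blockConst_cases x h with e | e | e | e <;> contradiction
  rw [if_neg hbc, if_neg h0, if_neg h1, if_neg h2, if_neg h3]; ring

/-- `(√2)⁻¹ ≠ 0` in `ℂ`. [folklore] -/
theorem sqrt_two_inv_ne_zero : ((Real.sqrt 2 : ℂ)⁻¹) ≠ 0 :=
  inv_ne_zero (Complex.ofReal_ne_zero.mpr (Real.sqrt_ne_zero'.mpr (by norm_num)))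

/-! ### Hamming-1 neighbours of the corners never collide (decided by the kernel) -/

/-- Neighbours of `0⁸` are not neighbours of `1⁴0⁴`, `0⁴1⁴`, `1⁸`. [folklore] -/
theorem flip_zero8_ne (j k : Fin (2 * 4)) :
    Function.update (fun _ : Fin (2 * 4) => false) k (!((fun _ : Fin (2 * 4) => false) k)) ≠
        Function.update (fun w : Fin (2 * 4) => decide (w.val < 4)) j
          (!((fun w : Fin (2 * 4) => decide (w.val < 4)) j)) ∧
      Function.update (fun _ : Fin (2 * 4) => false) k (!((fun _ : Fin (2 * 4) => false) k)) ≠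
        Function.update (fun w : Fin (2 * 4) => decide (4 ≤ w.val)) j
          (!((fun w : Fin (2 * 4) => decide (4 ≤ w.val)) j)) ∧
      Function.update (fun _ : Fin (2 * 4) => false) k (!((fun _ : Fin (2 * 4) => false) k)) ≠
        Function.update (fun _ : Fin (2 * 4) => true) j (!((fun _ : Fin (2 * 4) => true) j)) := by
  revert j k
  decide

/-- Neighbours of `1⁸` are not neighbours of `0⁸`, `1⁴0⁴`, `0⁴1⁴`. [folklore] -/
theorem flip_one8_ne (j k : Fin (2 * 4)) :
    Function.update (fun _ : Fin (2 * 4) => true) k (!((fun _ : Fin (2 * 4) => true) k)) ≠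
        Function.update (fun _ : Fin (2 * 4) => false) j (!((fun _ : Fin (2 * 4) => false) j)) ∧
      Function.update (fun _ : Fin (2 * 4) => true) k (!((fun _ : Fin (2 * 4) => true) k)) ≠
        Function.update (fun w : Fin (2 * 4) => decide (w.val < 4)) j
          (!((fun w : Fin (2 * 4) => decide (w.val < 4)) j)) ∧
      Function.update (fun _ : Fin (2 * 4) => true) k (!((fun _ : Fin (2 * 4) => true) k)) ≠
        Function.update (fun w : Fin (2 * 4) => decide (4 ≤ w.val)) j
          (!((fun w : Fin (2 * 4) => decide (4 ≤ w.val)) j)) := by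
  revert j k
  decide

/-! ### `|M⟩^{⊗2}` has trivial annihilator -/

/-- The amplitude of `c(A)|M⟩^{⊗2}` on the neighbour `e_k` of the corner `0⁸`:
`½ (A_{k,X} + i A_{k,Y})` up to the Jordan–Wigner sign. [folklore] -/
theorem row_mulVec_magicMPow_two_at_zero8 (A : Fin (2 * 4) × Bool → ℂ) (k : Fin (2 * 4)) :
    ((∑ p : Fin (2 * 4) × Bool, A p • majorana (2 * 4) p.1 p.2) *ᵥ magicMPow 2)
        (Function.update (fun _ : Fin (2 * 4) => false) k (!((fun _ : Fin (2 * 4) => false) k))) =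
      (((Real.sqrt 2 : ℂ)⁻¹) ^ 2) *
        ((∏ i ∈ Finset.univ.erase k, (if i < k then Pauli.Z else Pauli.I).mat
            ((fun _ : Fin (2 * 4) => false) i) ((fun _ : Fin (2 * 4) => false) i)) *
          (A (k, false) * Pauli.X.mat (!false) false + A (k, true) * Pauli.Y.mat (!false) false)) := by
  rw [magicMPow_two_eq_sum, Matrix.mulVec_smul, Matrix.mulVec_add, Matrix.mulVec_add, Matrix.mulVec_add,
    Pi.smul_apply, Pi.add_apply, Pi.add_apply, Pi.add_apply, smul_eq_mul, row_mulVec_basisState_flip,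
    row_mulVec_basisState_of_ne A _ _ (fun j => (flip_zero8_ne j k).1),
    row_mulVec_basisState_of_ne A _ _ (fun j => (flip_zero8_ne j k).2.1),
    row_mulVec_basisState_of_ne A _ _ (fun j => (flip_zero8_ne j k).2.2)]
  ring

/-- The amplitude of `c(A)|M⟩^{⊗2}` on the neighbour `1⁸ ⊕ e_k` of the corner `1⁸`:
`½ (A_{k,X} - i A_{k,Y})` up to the Jordan–Wigner sign. [folklore] -/
theorem row_mulVec_magicMPow_two_at_one8 (A : Fin (2 * 4) × Bool → ℂ) (k : Fin (2 * 4)) :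
    ((∑ p : Fin (2 * 4) × Bool, A p • majorana (2 * 4) p.1 p.2) *ᵥ magicMPow 2)
        (Function.update (fun _ : Fin (2 * 4) => true) k (!((fun _ : Fin (2 * 4) => true) k))) =
      (((Real.sqrt 2 : ℂ)⁻¹) ^ 2) *
        ((∏ i ∈ Finset.univ.erase k, (if i < k then Pauli.Z else Pauli.I).mat
            ((fun _ : Fin (2 * 4) => true) i) ((fun _ : Fin (2 * 4) => true) i)) *
          (A (k, false) * Pauli.X.mat (!true) true + A (k, true) * Pauli.Y.mat (!true) true)) := by
  rw [magicMPow_two_eq_sum, Matrix.mulVec_smul, Matrix.mulVec_add, Matrix.mulVec_add, Matrix.mulVec_add,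
    Pi.smul_apply, Pi.add_apply, Pi.add_apply, Pi.add_apply, smul_eq_mul, row_mulVec_basisState_flip,
    row_mulVec_basisState_of_ne A _ _ (fun j => (flip_one8_ne j k).1),
    row_mulVec_basisState_of_ne A _ _ (fun j => (flip_one8_ne j k).2.1),
    row_mulVec_basisState_of_ne A _ _ (fun j => (flip_one8_ne j k).2.2)]
  ring

/-- **`|M⟩^{⊗2}` has trivial annihilator**: the only linear combination `c(A) = Σ_p A_p c_p` of the
sixteen Jordan–Wigner Majoranas with `c(A)|M⟩^{⊗2} = 0` is `A = 0` (its annihilator space is `{0}`,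
so every Lagrangian meets it trivially and no Gaussian term can share an annihilator with it).
Proof: read the amplitudes of `c(A)|M⟩^{⊗2}` next to the corners `0⁸`, `1⁸`: `± ½ (A_{k,X} ± i A_{k,Y})`.
This is input (T1) of the paper proofs filed on stmt-QuantumAdvantage-1248 (cards
lagrangian-triple-rigidity §6, isotropy-defect-rank-four, annihilator-peeling). [folklore] -/
theorem magicMPow_two_annihilator_eq_zero (A : Fin (2 * 4) × Bool → ℂ)
    (h : (∑ p : Fin (2 * 4) × Bool, A p • majorana (2 * 4) p.1 p.2) *ᵥ magicMPow 2 = 0) : A = 0 := by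
  have hc : (((Real.sqrt 2 : ℂ)⁻¹) ^ 2) ≠ 0 := pow_ne_zero _ sqrt_two_inv_ne_zero
  funext p
  obtain ⟨k, b⟩ := p
  have e0 := row_mulVec_magicMPow_two_at_zero8 A k
  have e1 := row_mulVec_magicMPow_two_at_one8 A k
  rw [h, Pi.zero_apply] at e0 e1
  have e0' := (mul_eq_zero.mp ((mul_eq_zero.mp e0.symm).resolve_left hc)).resolve_left (jwSign_ne_zero _ _)
  have e1' := (mul_eq_zero.mp ((mul_eq_zero.mp e1.symm).resolve_left hc)).resolve_left (jwSign_ne_zero _ _)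
  obtain ⟨hX, hY⟩ := coeffs_eq_zero_of_pm e0' e1'
  cases b
  · exact hX
  · exact hY

/-- **`|M⟩^{⊗2}` is not Gaussian** (`χ_G(M⊗M) ≥ 2`): a Gaussian state has eight independent
annihilating rows and `|M⟩^{⊗2}` has none. [cite: CudbyStrelchuk2023, §6] -/
theorem magicMPow_two_not_isGaussian : ¬ IsGaussian (magicMPow 2) := by
  rintro ⟨-, A, hA, hann⟩
  exact (LinearIndependent.ne_zero 0 hA) (magicMPow_two_annihilator_eq_zero (A 0) (hann 0))

/-! ### The sharp annihilator-count threshold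

The crux's dictionary with the number `m` of independent annihilating rows as a parameter,
`ψ ≠ 0 ∧ ∃ A : Fin m → (Fin (2*4) × Bool → ℂ), LinearIndependent ℂ A ∧ ∀ k, c(A k) ψ = 0`
(`m = 8` is `IsGaussian`). `m ≤ 4`: the bound fails with TWO terms; any `m ≥ 1`: ONE term never
suffices; `m ∈ {5,6,7}`: implied by the crux (parity projections of such vectors are pure spinors,
since all even/odd spinors of `≤ 3` modes are pure) — recorded in the crux's Disproof.lean, not here. -/

/-- **One term never suffices**, however weak the dictionary (`m + 1 ≥ 1` annihilating rows): a single
term proportional to `|M⟩^{⊗2}` would hand its nonzero annihilating row to `|M⟩^{⊗2}`. [folklore] -/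
theorem gaussRankTwoCopies_oneTerm_free (m : ℕ) (a : Fin 1 → ℂ) (g : Fin 1 → QReg (2 * 4) → ℂ)
    (hg : ∀ i, g i ≠ 0 ∧ ∃ A : Fin (m + 1) → (Fin (2 * 4) × Bool → ℂ), LinearIndependent ℂ A ∧
      ∀ k, (∑ p : Fin (2 * 4) × Bool, A k p • majorana (2 * 4) p.1 p.2) *ᵥ g i = 0) :
    magicMPow 2 ≠ ∑ i, a i • g i := by
  intro heq
  rw [Fin.sum_univ_one] at heq
  obtain ⟨-, A, hA, hann⟩ := hg 0
  apply LinearIndependent.ne_zero 0 hA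
  apply magicMPow_two_annihilator_eq_zero (A 0)
  rw [heq, Matrix.mulVec_smul, hann 0, smul_zero]

/-- Two distinct basis states agreeing with the constant `c` on block `A` (wires `0–3`) form a vector
with four independent annihilating rows, the block-`A` modes `c_{k,X} + (-1)^c i c_{k,Y}`. [folklore] -/
theorem pair_fourAnnihilators (c : Bool) (x₁ x₂ : QReg (2 * 4))
    (h₁ : ∀ k : Fin 4, x₁ ⟨k.val, by omega⟩ = c) (h₂ : ∀ k : Fin 4, x₂ ⟨k.val, by omega⟩ = c)
    (hne : x₁ ≠ x₂) :
    basisState x₁ + basisState x₂ ≠ 0 ∧ ∃ A : Fin 4 → (Fin (2 * 4) × Bool → ℂ), LinearIndependent ℂ A ∧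
      ∀ k, (∑ p : Fin (2 * 4) × Bool, A k p • majorana (2 * 4) p.1 p.2) *ᵥ
        (basisState x₁ + basisState x₂) = 0 := by
  refine ⟨fun h0 => ?_, fun k p => if p.1 = (⟨k.val, by omega⟩ : Fin (2 * 4)) then
      (if p.2 then (if c then -Complex.I else Complex.I) else (1 : ℂ)) else 0, ?_, fun k => ?_⟩
  · have := congrFun h0 x₁
    simp [hne] at this
  · rw [Fintype.linearIndependent_iff]
    intro g hg k
    have h := congrFun hg ((⟨k.val, by omega⟩ : Fin (2 * 4)), false)
    simp only [Finset.sum_apply, Pi.smul_apply, smul_eq_mul, Pi.zero_apply] at h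
    simpa [Fin.val_inj] using h
  · rw [Matrix.mulVec_add, annRow_mulVec_basisState _ _ (h₁ k), annRow_mulVec_basisState _ _ (h₂ k),
      add_zero]

/-- **Sharp load-bearing threshold: four annihilating rows are not enough.** If the dictionary of
the crux only asks each term to be annihilated by FOUR linearly independent Majorana combinations
(instead of the eight of a pure spinor), `|M⟩^{⊗2}` is a combination of TWO dictionary vectors:
`½ |0⁴⟩⊗(|0⁴⟩+|1⁴⟩) + ½ |1⁴⟩⊗(|0⁴⟩+|1⁴⟩)`, each half killed by the four block-`A` modes. With
`gaussRankTwoCopies_oneTerm_free` the four-row rank of `M⊗M` is exactly `2`; so any proof of the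
crux must use at least five of the eight annihilating rows of every term. [folklore] -/
theorem gaussRankTwoCopies_false_with_four_annihilators :
    ¬ ∀ (a : Fin 2 → ℂ) (g : Fin 2 → QReg (2 * 4) → ℂ),
        (∀ i, g i ≠ 0 ∧ ∃ A : Fin 4 → (Fin (2 * 4) × Bool → ℂ), LinearIndependent ℂ A ∧
          ∀ k, (∑ p : Fin (2 * 4) × Bool, A k p • majorana (2 * 4) p.1 p.2) *ᵥ g i = 0) →
        magicMPow 2 ≠ ∑ i, a i • g i := by
  intro h
  refine h (fun _ => ((Real.sqrt 2 : ℂ)⁻¹) ^ 2)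
    ![basisState (fun _ : Fin (2 * 4) => false) + basisState (fun w : Fin (2 * 4) => decide (4 ≤ w.val)),
      basisState (fun w : Fin (2 * 4) => decide (w.val < 4)) + basisState (fun _ : Fin (2 * 4) => true)]
    ?_ ?_
  · intro i
    fin_cases i
    · exact pair_fourAnnihilators false _ _ (by decide) (by decide) (by decide)
    · exact pair_fourAnnihilators true _ _ (by decide) (by decide) (by decide)
  · rw [magicMPow_two_eq_sum, Fin.sum_univ_two, ← smul_add]
    congr 1
    simp only [Matrix.cons_val_zero, Matrix.cons_val_one]
    abel

end Summit.QuantumAdvantage.QuantumAdvantage.Theorems.GaussRankTwoCopies.Negative
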